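import Summits.ResolutionOfSingularities.ResolutionOfSingularities.Theorems.EquisingularLiftEquisingularLiftNatSpecimenConeChartsAllN
import Summits.ResolutionOfSingularities.ResolutionOfSingularities.Theorems.EquisingularLiftEquisingularLiftNatSpecimenLinearCone
import HarnessLib

/-!
# Crux `EquisingularLift` (stmt-ResolutionOfSingularities-15660), line `Sketch` (v10c): the OPEN residual `stub_blowupModel_ge_five` holds for
# CONES over regular hypersurfaces — in EVERY characteristic and every dimension (the residual's own currency)

[OURS · leafhand-res-equisingularlift-6 g2, 2026-08-31; cell `pub/decomp-res`] AI-produced, weaker than expert review; NOT a statement of any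
manuscript; nothing here proves resolution of singularities in positive characteristic.  DEF-FREE helper, `--supports stmt-…-15660`; standard
axioms; ZERO named hypotheses; every field `k`.

Bookkeeping only (one-line composition, no new mathematics): the all-`n` cone theorems of seat res-D-pv-013 (cell `res-hironaka`, chain w45b) —
✓ `ConeN.isRegular_of_isBlowup_comap` (every blow-up of the cone `H = V₊(G(x₁, …, x_{m+2})) ⊆ ℙ^{m+2}_k` along the trace `Λ·𝒪_H` of its vertex
`Λ = V₊(x₁, …, x_{m+2})` is a regular scheme, for every PRIME form `G ∈ k[T₀, …, T_{m+1}]` whose `m + 2` idle-variable charts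
`k[T]/(G|_{Tᵢ := 1})` are regular rings) and ✓ `ConeN.not_range_subset_support` (`ι(H) ⊄ V(Λ)`) — read in the currency of the registered
open residual of crux `EquisingularLift` (`stub_blowupModel_ge_five`: «`∃ 𝔞 ≠ ⊥` on `H` all of whose blow-ups are regular»), where the
tree so far records them only in route currency `ELNatAt` (✓ `ConeN.elNatAt_cone`):

* ★ `blowupModel_cone` — **for every field `k`, every `m`, every prime form `G ∈ k[T₀, …, T_{m+1}]` with regular idle-variable charts, the cone
  `H = V₊(G(x₁, …, x_{m+2})) ⊆ ℙ^{m+2}_k` has a non-zero ideal sheaf (`𝔞 = Λ·𝒪_H`, the vertex) ALL of whose blow-ups are regular** — an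
  ALL-CHARACTERISTIC family of instances (one in every ambient dimension `m + 2 ≥ 2`, e.g. `≥ 5`) of the conclusion of `stub_blowupModel_ge_five`
  (whose other known instances are: `n ≤ 2` ✓ `blowupModel_le_two`; large characteristic `p > M(n, d)` ✓ `blowupModel_largeChar`);
* `blowupModel_cone_of_isNonsingularForm` — the cones over NONSINGULAR forms of degree `d ≥ 1` (`m ≥ 1`; ✓ `IsNonsingularForm.prime`,
  ✓ `Cone.isRegularRing_quotient_aeval_update_one_of_isNonsingularForm`), e.g. the Fermat cones `V₊(x₁ᵈ + ⋯ + x_{m+2}ᵈ)` with `d ≠ 0` in `k`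
  (✓ `isNonsingularForm_sum_X_pow`) and the quadric cones of corank one.

Honest label: no registered stub closed; `stub_blowupModel_ge_five` (= projective resolution of hypersurfaces of dimension `≥ 4` over `k̄`)
stays OPEN; these are its cone instances, already in the tree in route currency.  For arbitrary QUADRICS (lh6 g0 census) two pieces remain:
(q1) `PGL_{n+1}(k)`-transport of the currencies to move a vertex into coordinate position, (q2) char-free normal forms of prime quadratic
forms over `k̄`; the coordinate cones with vertex `ℙʳ` are ✓ `elNatAt_linCone`.

References: [Hartshorne1977, II Ex. 7.12]; [StacksProject, Tag 0804]; [GortzWedhorn2020, Prop. 13.96 (2)] — through the cited tree files.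
-/

set_option linter.dupNamespace false -- mandated namespace `Summit.<Summit>.<Problem>` of this single-conjunct summit

noncomputable section

open CategoryTheory CategoryTheory.Limits AlgebraicGeometry TopologicalSpace
open MvPolynomial HomogeneousLocalization
open Literature.AlgebraicGeometry.Resolution
open Literature.AlgebraicGeometry.Motives Literature.AlgebraicGeometry.Motives.SmoothHypersurface
open Literature.AlgebraicGeometry.Motives.ProjectiveSpace
open AlgebraicGeometry.Scheme.IdealSheafData
open Summit.ResolutionOfSingularities.ResolutionOfSingularities.Cruxes.EquisingularLiftNat.Sections

universe u

namespace Summit.ResolutionOfSingularities.ResolutionOfSingularities.Cruxes.EquisingularLift.StrataSplit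

/-- ★ **Cones over regular hypersurfaces have regular blow-up models — every field, every characteristic, every dimension.**  For a prime form
`G ∈ k[T₀, …, T_{m+1}]` whose idle-variable charts `k[T]/(G|_{Tᵢ := 1})` are regular rings, the cone `H = V₊(G(x₁, …, x_{m+2})) ⊆ ℙ^{m+2}_k`
carries a non-zero ideal sheaf — the trace `Λ·𝒪_H` of its vertex `Λ = V₊(x₁, …, x_{m+2})` — all of whose blow-ups are regular schemes
(✓ `ConeN.isRegular_of_isBlowup_comap`; non-zero because `ι(H) ⊄ V(Λ)`, ✓ `ConeN.not_range_subset_support`).  This is the conclusion of the open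
residual `stub_blowupModel_ge_five` at these `H`. [cite: Hartshorne1977, II Ex. 7.12] [cite: StacksProject, Tag 0804] -/
theorem blowupModel_cone (k : Type) [Field k] {m : ℕ} (G : MvPolynomial (Fin (m + 2)) k) {d : ℕ} (hG : G.IsHomogeneous d)
    (hGp : Prime G)
    (hreg : ∀ i : Fin (m + 2), IsRegularRing (MvPolynomial (Fin (m + 2)) k ⧸
      Ideal.span {aeval (Function.update (X : Fin (m + 2) → MvPolynomial (Fin (m + 2)) k) i 1) G})) :
    letI := MvPolynomial.gradedAlgebra (σ := Fin (m + 2 + 1)) (R := k)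
    ∃ 𝔞 : (hypersurface (rename Fin.succ G : MvPolynomial (Fin (m + 2 + 1)) k)).left.IdealSheafData, 𝔞 ≠ ⊥ ∧
      ∀ (Z : Scheme.{0}) (π : Z ⟶ (hypersurface (rename Fin.succ G : MvPolynomial (Fin (m + 2 + 1)) k)).left),
        IsBlowup π 𝔞 → Scheme.IsRegular Z := by
  letI := MvPolynomial.gradedAlgebra (σ := Fin (m + 2 + 1)) (R := k)
  letI := MvPolynomial.gradedAlgebra (σ := Fin (0 + 1)) (R := k)
  have hF : (rename Fin.succ G : MvPolynomial (Fin (m + 2 + 1)) k).IsHomogeneous d := ConeN.isHomogeneous_rename_succ k G hG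
  have hd : 0 < d := ConeN.pos_of_prime_of_isHomogeneous k G hG hGp
  let e : Fin 1 → Fin (m + 2 + 1) := fun _ => 0
  have he0 : ∀ j, e j = 0 := fun _ => rfl
  have he : Function.Injective e := Function.injective_of_subsingleton e
  obtain ⟨fk, hfk', hfkC, hfke, hfk0⟩ :=
    Summit.ResolutionOfSingularities.ResolutionOfSingularities.Cruxes.EquisingularLiftNat.LinearCentre.exists_kill (R := k) e he
  refine ⟨(Proj.map fk hfk').ker.comap (hypersurfaceι (rename Fin.succ G : MvPolynomial (Fin (m + 2 + 1)) k)).left, ?_,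
    fun Z ρ hρ => ConeN.isRegular_of_isBlowup_comap k G hG hF hd hGp hreg e he0 fk hfk' hfkC hfke hfk0 Z ρ hρ⟩
  intro h0
  apply ConeN.not_range_subset_support k G hF hGp e he0 fk hfk' hfkC hfke hfk0
  rintro _ ⟨x, rfl⟩
  have hx : x ∈ (((Proj.map fk hfk').ker.comap
      (hypersurfaceι (rename Fin.succ G : MvPolynomial (Fin (m + 2 + 1)) k)).left).support :
        Set (hypersurface (rename Fin.succ G : MvPolynomial (Fin (m + 2 + 1)) k)).left) := by
    rw [h0, Scheme.IdealSheafData.support_bot]; trivial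
  rwa [Scheme.IdealSheafData.support_comap] at hx

/-- **Cones over NONSINGULAR forms have regular blow-up models** (`m ≥ 1`; every field): a nonsingular form is prime (✓ `IsNonsingularForm.prime`)
with regular idle-variable charts (✓ `Cone.isRegularRing_quotient_aeval_update_one_of_isNonsingularForm`). [cite: Hartshorne1977, II Ex. 7.12] -/
theorem blowupModel_cone_of_isNonsingularForm (k : Type) [Field k] {m : ℕ} (hm : 1 ≤ m) (G : MvPolynomial (Fin (m + 2)) k) {d : ℕ}
    (hG : G.IsHomogeneous d) (hd : 1 ≤ d) (hns : IsNonsingularForm k G) :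
    letI := MvPolynomial.gradedAlgebra (σ := Fin (m + 2 + 1)) (R := k)
    ∃ 𝔞 : (hypersurface (rename Fin.succ G : MvPolynomial (Fin (m + 2 + 1)) k)).left.IdealSheafData, 𝔞 ≠ ⊥ ∧
      ∀ (Z : Scheme.{0}) (π : Z ⟶ (hypersurface (rename Fin.succ G : MvPolynomial (Fin (m + 2 + 1)) k)).left),
        IsBlowup π 𝔞 → Scheme.IsRegular Z :=
  blowupModel_cone k G hG (hns.prime hm hd hG) fun i => Cone.isRegularRing_quotient_aeval_update_one_of_isNonsingularForm k G hG hns i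

/-! ## (append #1, leafhand-res-equisingularlift-6 g2) Cones with a LINEAR vertex `ℙʳ` (✓ `LinCone.isRegular_of_isBlowup_comap`, …NatSpecimenLinearCone)

The same bookkeeping for seat res-D-pv-013's linear cones: every quadric `V₊(G(x_{ι 0}, …, x_{ι (m+1)})) ⊆ ℙⁿ⁺¹_k` with `G` a NONSINGULAR
quadratic form in `m + 2` of the variables is such a cone (vertex = the coordinate `ℙʳ` of the remaining variables), so — up to the two pieces
NOT in the tree, (q1′) transport of blow-up models along `H ≅ H'` / `PGL_{n+2}(k)` and (q2) char-free normal forms of prime quadratic forms over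
`k̄` — this is the degree-2 slice of the residual in every characteristic. -/

/-- ★ **Cones with vertex `ℙʳ` over regular hypersurfaces have regular blow-up models — every field, every characteristic, every dimension.**
For a prime form `G ∈ k[T₀, …, T_{m+1}]` whose idle-variable charts are regular rings and complementary injective `ι : Fin (m+2) → Fin (n+2)`,
`e : Fin (r+1) → Fin (n+2)`, the cone `H = V₊(G(x_{ι 0}, …, x_{ι (m+1)})) ⊆ ℙⁿ⁺¹_k` with vertex `L = V(x_a : a ∉ range e) ≅ ℙʳ` carries a non-zero
ideal sheaf — the trace `L·𝒪_H` — all of whose blow-ups are regular (✓ `LinCone.isRegular_of_isBlowup_comap`; non-zero by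
✓ `LinCone.not_range_subset_support`): the conclusion of the open residual `stub_blowupModel_ge_five` at these `H` (in particular at every
quadric `V₊(G(x_{ι ·}))`, `G` a nonsingular quadratic form, whose singular locus is the linear space `L`).
[cite: Hartshorne1977, II Ex. 7.12] [cite: StacksProject, Tag 0804] -/
theorem blowupModel_linCone (k : Type) [Field k] {n r m : ℕ} (ι : Fin (m + 2) → Fin (n + 2)) (hι : Function.Injective ι)
    (e : Fin (r + 1) → Fin (n + 2)) (he : Function.Injective e) (hιe : ∀ l, ι l ∉ Set.range e)
    (heι : ∀ a, a ∉ Set.range e → a ∈ Set.range ι) (G : MvPolynomial (Fin (m + 2)) k) {d : ℕ} (hG : G.IsHomogeneous d) (hGp : Prime G)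
    (hreg : ∀ i : Fin (m + 2), IsRegularRing (MvPolynomial (Fin (m + 2)) k ⧸
      Ideal.span {aeval (Function.update (X : Fin (m + 2) → MvPolynomial (Fin (m + 2)) k) i 1) G})) :
    letI := MvPolynomial.gradedAlgebra (σ := Fin (n + 2)) (R := k)
    ∃ 𝔞 : (hypersurface (rename ι G)).left.IdealSheafData, 𝔞 ≠ ⊥ ∧
      ∀ (Z : Scheme.{0}) (π : Z ⟶ (hypersurface (rename ι G)).left), IsBlowup π 𝔞 → Scheme.IsRegular Z := by
  letI := MvPolynomial.gradedAlgebra (σ := Fin (n + 2)) (R := k)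
  letI := MvPolynomial.gradedAlgebra (σ := Fin (r + 1)) (R := k)
  have hF : (rename ι G).IsHomogeneous d := hG.rename_isHomogeneous
  have hd : 0 < d := ConeN.pos_of_prime_of_isHomogeneous k G hG hGp
  obtain ⟨fk, hfk', hfkC, hfke, hfk0⟩ :=
    Summit.ResolutionOfSingularities.ResolutionOfSingularities.Cruxes.EquisingularLiftNat.LinearCentre.exists_kill (R := k) e he
  refine ⟨(Proj.map fk hfk').ker.comap (hypersurfaceι (rename ι G)).left, ?_,
    fun Z ρ hρ => LinCone.isRegular_of_isBlowup_comap k ι hι e hιe heι G hG hF hd hGp hreg fk hfk' hfkC hfke hfk0 he Z ρ hρ⟩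
  intro h0
  apply LinCone.not_range_subset_support k ι hι e hιe G hF hGp fk hfk' hfkC hfke hfk0
  rintro _ ⟨x, rfl⟩
  have hx : x ∈ (((Proj.map fk hfk').ker.comap (hypersurfaceι (rename ι G)).left).support : Set (hypersurface (rename ι G)).left) := by
    rw [h0, Scheme.IdealSheafData.support_bot]; trivial
  rwa [Scheme.IdealSheafData.support_comap] at hx

/-- **Cones with vertex `ℙʳ` over NONSINGULAR forms of degree `d ≥ 1` have regular blow-up models** (`m ≥ 1`; every field). [cite: Hartshorne1977, II Ex. 7.12] -/
theorem blowupModel_linCone_of_isNonsingularForm (k : Type) [Field k] {n r m : ℕ} (hm : 1 ≤ m) (ι : Fin (m + 2) → Fin (n + 2))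
    (hι : Function.Injective ι) (e : Fin (r + 1) → Fin (n + 2)) (he : Function.Injective e) (hιe : ∀ l, ι l ∉ Set.range e)
    (heι : ∀ a, a ∉ Set.range e → a ∈ Set.range ι) (G : MvPolynomial (Fin (m + 2)) k) {d : ℕ} (hG : G.IsHomogeneous d) (hd : 1 ≤ d)
    (hns : IsNonsingularForm k G) :
    letI := MvPolynomial.gradedAlgebra (σ := Fin (n + 2)) (R := k)
    ∃ 𝔞 : (hypersurface (rename ι G)).left.IdealSheafData, 𝔞 ≠ ⊥ ∧
      ∀ (Z : Scheme.{0}) (π : Z ⟶ (hypersurface (rename ι G)).left), IsBlowup π 𝔞 → Scheme.IsRegular Z :=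
  blowupModel_linCone k ι hι e he hιe heι G hG (hns.prime hm hd hG)
    fun i => Cone.isRegularRing_quotient_aeval_update_one_of_isNonsingularForm k G hG hns i

end Summit.ResolutionOfSingularities.ResolutionOfSingularities.Cruxes.EquisingularLift.StrataSplit

end
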